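import Literature.Computability.AlgebraicComplexity.KIReductionBricksLayers
import HarnessLib

/-!
# Kabanets–Impagliazzo, Cor. 12: the reduction machine, III — sizes and offsets in unary, operand pieces

Seventh file of the discharge of the reduction fact
`Literature.Computability.AlgebraicComplexity.permanent01Graph_polyExists_preimage_PIT`
(`PermanentGraphNSUBEXP.lean`), continuing `KIReductionBricksLayers.lean`. The code of a level
of the instance refers to absolute gate indices (`KIReductionLayout.lean`: `useLen`, `levelLen`,
`levelBase`, `roundBase`); the machine holds all of them in UNARY (a string of that length) and
converts with `lenBinF` when an operand code is written. This file provides: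

* the accessors of the input `w₀ = ⟨x, y⟩` (`yStr`, `uStr`, `rowsStr`, `vcStr`, `bsStr`; the
  parsed dimension `nOf w₀ = |uStr w₀|`) and their bricks;
* `cntF W = 1^{#items of W}` (a fold), `usF ⟨w₀, 1ⁱ⟩ = 1^{|P i|}` for `P = readBlocks y`
  (`Sz`), `unF w₀ = 1^{n²}`;
* `levelLenF ⟨w₀, 1ⁱ⟩ = 1^{levelLen n P i}`, **`baseF ⟨w₀, u⟩ = 1^{levelBase n P |u|}`** (a fold:
  a concatenation of unary numerals is the numeral of the sum);
* the operand pieces on unary index pieces — `gateOpF f` (`1 · bin |f z|`), `varOpF f`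
  (`00 · bin |f z|`), `constVOpF` (the constant `v` parsed from the input) — and the frames
  `sum2F c₁ c₂ f₁ f₂`, `prod2F f₁ f₂` of the binary sum/product gates of the identities, with
  values and length formulas.

## References

* V. Kabanets, R. Impagliazzo, *Derandomizing polynomial identity tests means proving circuit
  lower bounds*, STOC 2003, Lemma 11 and proof of Cor. 12 (p. 358).
* S. Arora, B. Barak, *Computational Complexity: A Modern Approach*, CUP 2009, §1.3.
-/

noncomputable section

namespace Literature.Computability.AlgebraicComplexity

namespace KIReduction

open _root_.Computability Complexity Brick OracleCompose HashBricks Plumb Polynomial ArithCircuit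

/-! ### Accessors of the input `w₀ = ⟨x, y⟩`, `x = ⟨⟨bin n, ⟨1ⁿ, rows⟩⟩, bin v⟩` -/

/-- The guess `y`. [folklore] -/
def yStr (w₀ : List Bool) : List Bool := sndF w₀
/-- The unary dimension field `1ⁿ` of the matrix code (read by length: `n = |uStr w₀|`). [folklore] -/
def uStr (w₀ : List Bool) : List Bool := fstF (sndF (fstF (fstF w₀)))
/-- The rows field of the matrix code. [folklore] -/
def rowsStr (w₀ : List Bool) : List Bool := sndF (sndF (fstF (fstF w₀)))
/-- The value field `bin v`. [folklore] -/
def vcStr (w₀ : List Bool) : List Bool := sndF (fstF w₀)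
/-- The parsed dimension `n`. [folklore] -/
def nOf (w₀ : List Bool) : ℕ := (uStr w₀).length
/-- The string of block `i` of the guess: item `i` of `y`. [folklore] -/
def bsStr (w₀ : List Bool) (i : ℕ) : List Bool := fstF (sndF^[i] (yStr w₀))
/-- The guessed family read off the input: `readBlocks y`. [cite: KabanetsImpagliazzo2003, proof of Cor. 12 (p. 358)] -/
def blocksOf (w₀ : List Bool) : ℕ → KBlock := readBlocks (yStr w₀)

/-- Block `i` is read off its string. [folklore] -/
theorem blocksOf_eq (w₀ : List Bool) (i : ℕ) : blocksOf w₀ i = readBlock (bsStr w₀ i) := rfl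

/-- The number of gates of block `i`. [folklore] -/
theorem length_blocksOf (w₀ : List Bool) (i : ℕ) : (blocksOf w₀ i).length = (readList (bsStr w₀ i)).length := by
  rw [blocksOf_eq, readBlock, List.length_map]

/-- A block string is no longer than the input. [folklore] -/
theorem length_bsStr_le (w₀ : List Bool) (i : ℕ) : (bsStr w₀ i).length ≤ w₀.length :=
  (length_fstF_le' _).trans ((length_sndF_iterate_le _ _).trans (length_sndF_le' _))

/-- A block has at most `|w₀|` gates. [folklore] -/
theorem length_blocksOf_le (w₀ : List Bool) (i : ℕ) : (blocksOf w₀ i).length ≤ w₀.length := by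
  rw [length_blocksOf]; exact (length_readList_le _).trans (length_bsStr_le w₀ i)

/-- `n ≤ |w₀|`. [folklore] -/
theorem nOf_le (w₀ : List Bool) : nOf w₀ ≤ w₀.length :=
  (length_fstF_le' _).trans ((length_sndF_le' _).trans ((length_fstF_le' _).trans (length_fstF_le' _)))

/-- `|rowsStr w₀| ≤ |w₀|`. [folklore] -/
theorem length_rowsStr_le (w₀ : List Bool) : (rowsStr w₀).length ≤ w₀.length :=
  (length_sndF_le' _).trans ((length_sndF_le' _).trans ((length_fstF_le' _).trans (length_fstF_le' _)))

/-- `|vcStr w₀| ≤ |w₀|`. [folklore] -/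
theorem length_vcStr_le (w₀ : List Bool) : (vcStr w₀).length ≤ w₀.length :=
  (length_sndF_le' _).trans (length_fstF_le' _)

/-- The accessor bricks. [folklore] -/
def uF : List Bool → List Bool := fstF ∘ sndF ∘ fstF ∘ fstF
/-- The rows accessor brick. [folklore] -/
def rowsF : List Bool → List Bool := sndF ∘ sndF ∘ fstF ∘ fstF
/-- The value accessor brick. [folklore] -/
def vcF : List Bool → List Bool := sndF ∘ fstF

/-- `uF = uStr`. [folklore] -/
@[simp] theorem uF_apply (w₀ : List Bool) : uF w₀ = uStr w₀ := rfl
/-- `rowsF = rowsStr`. [folklore] -/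
@[simp] theorem rowsF_apply (w₀ : List Bool) : rowsF w₀ = rowsStr w₀ := rfl
/-- `vcF = vcStr`. [folklore] -/
@[simp] theorem vcF_apply (w₀ : List Bool) : vcF w₀ = vcStr w₀ := rfl

/-- `uF ∈ FP`. [folklore] -/
theorem uF_mem_FP : uF ∈ FP := comp_mem_FP fstF_mem_FP (comp_mem_FP sndF_mem_FP (comp_mem_FP fstF_mem_FP fstF_mem_FP))
/-- `rowsF ∈ FP`. [folklore] -/
theorem rowsF_mem_FP : rowsF ∈ FP := comp_mem_FP sndF_mem_FP (comp_mem_FP sndF_mem_FP (comp_mem_FP fstF_mem_FP fstF_mem_FP))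
/-- `vcF ∈ FP`. [folklore] -/
theorem vcF_mem_FP : vcF ∈ FP := comp_mem_FP sndF_mem_FP fstF_mem_FP

/-- The block-string brick on `⟨w₀, 1ⁱ⟩`: item `i` of `y = sndF w₀`. [folklore] -/
def bsF : List Bool → List Bool := nthItemFn ∘ fanoutFn sndF (sndF ∘ fstF)

/-- `bsF ∈ FP`. [folklore] -/
theorem bsF_mem_FP : bsF ∈ FP := comp_mem_FP nthItemFn_mem_FP (fanoutFn_mem_FP sndF_mem_FP (comp_mem_FP sndF_mem_FP fstF_mem_FP))

/-- Value of `bsF` (any index string of length `i`). [folklore] -/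
@[simp] theorem bsF_apply (w₀ u : List Bool) : bsF (boolPair w₀ u) = bsStr w₀ u.length := by
  simp [bsF, nthItemFn_boolPair, bsStr, yStr]

/-! ### Counting items: `cntF W = 1^{#items}` -/

/-- The counting piece on `⟨W, 1ᵗ⟩`: `1` while items remain, nothing after. [folklore] -/
def cntPieceF : List Bool → List Bool := iteFn (isNilFn ∘ dropItemsFn ∘ fanoutFn sndF fstF) (fun _ => []) (fun _ => [true])

/-- `cntPieceF ∈ FP`. [folklore] -/
theorem cntPieceF_mem_FP : cntPieceF ∈ FP :=
  iteFn_mem_FP (comp_mem_FP isNilFn_mem_FP (comp_mem_FP dropItemsFn_mem_FP (fanoutFn_mem_FP sndF_mem_FP fstF_mem_FP)))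
    (const_mem_FP _) (const_mem_FP _)

/-- Value of the counting piece. [folklore] -/
theorem cntPieceF_apply (W : List Bool) (t : ℕ) :
    cntPieceF (boolPair W (ones t)) = if t < (readList W).length then [true] else [] := by
  unfold cntPieceF
  rw [iteFn_of_oneBit (oneBit_isNilFn.comp _)]
  simp only [Function.comp_apply, fanoutFn_apply, sndF_boolPair, fstF_boolPair, dropItemsFn_boolPair, ones,
    List.length_replicate, isNilFn]
  by_cases h : t < (readList W).length
  · rw [if_pos h, if_neg]; simpa using iterate_sndF_ne_nil W h
  · rw [if_neg h, if_pos]; simpa using iterate_sndF_eq_nil W (not_lt.1 h)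

/-- **The item counter**: `cntF W = 1^{#items of W}` (a fold of the counting piece over `|W|` rounds). [folklore] -/
def cntF : List Bool → List Bool := foldCat 1 X cntPieceF ∘ fanoutFn id id

/-- `cntF ∈ FP`. [folklore] -/
theorem cntF_mem_FP : cntF ∈ FP := comp_mem_FP (foldCat_mem_FP _ _ cntPieceF_mem_FP) (fanoutFn_mem_FP id_mem_FP id_mem_FP)

/-- A concatenation of `k` copies of `1` then nothing is `1ᵏ`. [folklore] -/
theorem ccat_indicator (k : ℕ) : ∀ m, ccat (fun t => if t < k then [true] else []) m = ones (min m k)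
  | 0 => by simp [ones]
  | m + 1 => by
    rw [ccat_succ, ccat_indicator k m]
    by_cases h : m < k
    · rw [if_pos h, Nat.min_eq_left h.le, Nat.min_eq_left h]; simp [ones, List.replicate_succ']
    · rw [if_neg h, List.append_nil, Nat.min_eq_right (not_lt.1 h), Nat.min_eq_right (by omega)]

/-- **Value of the item counter.** [folklore] -/
@[simp] theorem cntF_apply (W : List Bool) : cntF W = ones (readList W).length := by
  rw [cntF, Function.comp_apply, fanoutFn_apply, id,
    foldCat_apply (p := X) (by simp) (fun t _ => by rw [cntPieceF_apply]; split_ifs <;> simp),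
    ccat_congr (fun t _ => cntPieceF_apply W t), ccat_indicator, Nat.min_eq_right (length_readList_le W)]

/-- The number of gates of block `i`, `Sz w₀ i = |P i|`. [folklore] -/
def Sz (w₀ : List Bool) (i : ℕ) : ℕ := (blocksOf w₀ i).length

/-- **The block-size brick** on `⟨w₀, 1ⁱ⟩`: `1^{|P i|}`. [folklore] -/
def usF : List Bool → List Bool := cntF ∘ bsF

/-- `usF ∈ FP`. [folklore] -/
theorem usF_mem_FP : usF ∈ FP := comp_mem_FP cntF_mem_FP bsF_mem_FP

/-- Value of the block-size brick. [folklore] -/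
@[simp] theorem usF_apply (w₀ u : List Bool) : usF (boolPair w₀ u) = ones (Sz w₀ u.length) := by
  simp [usF, Sz, length_blocksOf]

/-- `Sz w₀ i ≤ |w₀|`. [folklore] -/
theorem Sz_le (w₀ : List Bool) (i : ℕ) : Sz w₀ i ≤ w₀.length := length_blocksOf_le w₀ i

/-- **The squared-dimension brick**: `unF w₀ = 1^{n²}`. [folklore] -/
def unF : List Bool → List Bool := umulFn ∘ fanoutFn uF uF

/-- `unF ∈ FP`. [folklore] -/
theorem unF_mem_FP : unF ∈ FP := comp_mem_FP umulFn_mem_FP (fanoutFn_mem_FP uF_mem_FP uF_mem_FP)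

/-- Value of `unF`. [folklore] -/
@[simp] theorem unF_apply (w₀ : List Bool) : unF w₀ = ones (nOf w₀ * nOf w₀) := by
  simp [unF, umulFn_apply, nOf]

/-! ### Level lengths and offsets in unary -/

/-- `1ᵃ ++ 1ᵇ = 1^{a+b}` (twins, outside this file's import cone: `StackUnary.lean`, `Learning/LearnerParamsFP.lean`). [folklore] -/
theorem ones_append (a b : ℕ) : ones a ++ ones b = ones (a + b) := by simp [ones]

/-- `true :: 1ᵃ = 1^{a+1}` (twins, outside this file's import cone: `MetaComplexity/UHSPadParams.lean`,
`Cryptography/LiuPassCondRedProgram.lean`). [folklore] -/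
theorem true_cons_ones (a : ℕ) : true :: ones a = ones (a + 1) := by simp [ones, List.replicate_succ]

/-- `useLen n (P i) = n² + |P i| + 1` in unary: `1^{n²} ++ 1^{|P i|} ++ 1`. [folklore] -/
theorem ones_useLen (w₀ : List Bool) (i : ℕ) :
    ones (nOf w₀ * nOf w₀) ++ ones (Sz w₀ i) ++ [true] = ones (useLen (nOf w₀) (blocksOf w₀ i)) := by
  rw [useLen, ← Sz, ones_append, show [true] = ones 1 from rfl, ones_append]

/-- **The level-length piece** on `⟨w₀, 1ⁱ⟩`: `1^{levelLen n P i}` — for `i = 0`: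
`useLen (P 0) + 3`; else `useLen (P i) + i (useLen (P (i-1)) + 2) + 2`, the product by `umulFn`. [folklore] -/
def levelLenF : List Bool → List Bool :=
  iteFn (isNilFn ∘ sndF)
    (fun z => ((unF ∘ fstF) z ++ usF z) ++ [true, true, true, true])
    (fun z => (((unF ∘ fstF) z ++ usF z) ++
      (umulFn ∘ fanoutFn sndF (fun z => ((unF ∘ fstF) z ++ (usF ∘ fanoutFn fstF (List.tail ∘ sndF)) z) ++ [true, true, true])) z) ++
        [true, true, true])

/-- `levelLenF ∈ FP`. [folklore] -/
theorem levelLenF_mem_FP : levelLenF ∈ FP :=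
  iteFn_mem_FP (comp_mem_FP isNilFn_mem_FP sndF_mem_FP)
    (append_mem_FP (append_mem_FP (comp_mem_FP unF_mem_FP fstF_mem_FP) usF_mem_FP) (const_mem_FP _))
    (append_mem_FP (append_mem_FP (append_mem_FP (comp_mem_FP unF_mem_FP fstF_mem_FP) usF_mem_FP)
      (comp_mem_FP umulFn_mem_FP (fanoutFn_mem_FP sndF_mem_FP
        (append_mem_FP (append_mem_FP (comp_mem_FP unF_mem_FP fstF_mem_FP)
          (comp_mem_FP usF_mem_FP (fanoutFn_mem_FP fstF_mem_FP (comp_mem_FP PRelSigma.tail_mem_FP sndF_mem_FP)))) (const_mem_FP _)))))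
      (const_mem_FP _))

/-- **Value of the level-length piece.** [folklore] -/
theorem levelLenF_apply (w₀ : List Bool) (i : ℕ) :
    levelLenF (boolPair w₀ (ones i)) = ones (levelLen (nOf w₀) (blocksOf w₀) i) := by
  have h3 : [true, true, true] = ones 3 := rfl
  have h4 : [true, true, true, true] = ones 4 := rfl
  unfold levelLenF levelLen
  by_cases hi : i = 0
  · subst hi
    rw [iteFn_apply_true (by simp [isNilFn, ones]), if_pos rfl]
    simp only [Function.comp_apply, fstF_boolPair, unF_apply, usF_apply, h4]
    simp only [ones, List.length_replicate, List.replicate_append_replicate, useLen, Sz]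
  · rw [iteFn_apply_false (by simp [isNilFn, ones, hi]), if_neg hi]
    have ht : (List.tail (ones i)).length = i - 1 := by simp [ones]
    simp only [Function.comp_apply, fstF_boolPair, sndF_boolPair, fanoutFn_apply, unF_apply, usF_apply, ht,
      umulFn_apply, h3]
    simp only [ones, List.length_replicate, List.replicate_append_replicate, useLen, Sz]
    congr 1
    ring

/-- Length of the level-length piece: the level length. [folklore] -/
theorem length_levelLenF (w₀ : List Bool) (i : ℕ) :
    (levelLenF (boolPair w₀ (ones i))).length = levelLen (nOf w₀) (blocksOf w₀) i := by
  rw [levelLenF_apply]; simp [ones]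

/-- The clip polynomial of the offset fold: `levelLen i ≤ (|w₀| + 3)³` for `i ≤ |w₀| + 1`. [folklore] -/
def baseQ : Polynomial ℕ := (X + 3) ^ 3

/-- A level of the run is at most `(|w₀| + 3)³` gates long (`i ≤ |w₀| + 1`). [folklore] -/
theorem levelLen_le_cube (w₀ : List Bool) {i : ℕ} (hi : i ≤ w₀.length + 1) :
    levelLen (nOf w₀) (blocksOf w₀) i ≤ (w₀.length + 3) ^ 3 := by
  have h := levelLen_le (n := nOf w₀) (P := blocksOf w₀) (s := w₀.length) (length_blocksOf_le w₀) i
  have hn : nOf w₀ * nOf w₀ ≤ w₀.length * w₀.length := Nat.mul_le_mul (nOf_le w₀) (nOf_le w₀)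
  calc levelLen (nOf w₀) (blocksOf w₀) i ≤ (i + 1) * (nOf w₀ * nOf w₀ + w₀.length + 3) + 3 := h
    _ ≤ (w₀.length + 2) * (w₀.length * w₀.length + w₀.length + 3) + 3 :=
        Nat.add_le_add_right (Nat.mul_le_mul (by omega) (by omega)) 3
    _ ≤ (w₀.length + 3) ^ 3 := by nlinarith

/-- **The offset brick** on `⟨w₀, u⟩`: `1^{levelBase n P |u|}`, the fold of the level-length
pieces (`|u| ≤ |w₀| + 1` rounds). [cite: KabanetsImpagliazzo2003, proof of Cor. 12 (p. 358)] -/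
def baseF : List Bool → List Bool := foldCat baseQ (X + 1) levelLenF

/-- `baseF ∈ FP`. [folklore] -/
theorem baseF_mem_FP : baseF ∈ FP := foldCat_mem_FP _ _ levelLenF_mem_FP

/-- A concatenation of level lengths is the offset. [folklore] -/
theorem ccat_levelLen (w₀ : List Bool) : ∀ m,
    ccat (fun i => levelLenF (boolPair w₀ (ones i))) m = ones (levelBase (nOf w₀) (blocksOf w₀) m)
  | 0 => by simp [levelBase, ones]
  | m + 1 => by rw [ccat_succ, ccat_levelLen w₀ m, levelLenF_apply, ones_append, levelBase]

/-- **Value of the offset brick** (`|u| ≤ |w₀| + 1`). [folklore] -/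
theorem baseF_apply (w₀ u : List Bool) (hu : u.length ≤ w₀.length + 1) :
    baseF (boolPair w₀ u) = ones (levelBase (nOf w₀) (blocksOf w₀) u.length) := by
  rw [baseF, foldCat_apply (p := X + 1) (by simpa using hu) (fun t ht => ?_), ccat_levelLen]
  rw [length_levelLenF]
  simpa [baseQ] using levelLen_le_cube w₀ (by omega)

/-- The offsets of the run: `levelBase i ≤ i (|w₀| + 3)³`. [folklore] -/
theorem levelBase_le_mul_cube (w₀ : List Bool) {i : ℕ} (hi : i ≤ w₀.length + 1) :
    levelBase (nOf w₀) (blocksOf w₀) i ≤ i * (w₀.length + 3) ^ 3 := by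
  induction i with
  | zero => simp [levelBase]
  | succ i ih =>
    rw [levelBase, Nat.succ_mul]
    exact Nat.add_le_add (ih (by omega)) (levelLen_le_cube w₀ (by omega))

/-! ### Operand pieces on unary index pieces -/

/-- **The gate-reference piece**: `gateOpF f z = 1 · bin |f z|`, the code of `gate |f z|`. [folklore] -/
def gateOpF (f : List Bool → List Bool) : List Bool → List Bool := List.cons true ∘ lenBinF ∘ f

/-- `gateOpF f ∈ FP`. [folklore] -/
theorem gateOpF_mem_FP {f : List Bool → List Bool} (hf : f ∈ FP) : gateOpF f ∈ FP :=
  comp_mem_FP (cons_mem_FP true) (comp_mem_FP lenBinF_mem_FP hf)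

/-- Value of the gate-reference piece. [folklore] -/
theorem gateOpF_apply (N : ℕ) (f : List Bool → List Bool) (z : List Bool) :
    gateOpF f z = opCode N (.gate (f z).length) := by
  simp [gateOpF]

/-- Length of the gate-reference piece: `≤ |f z| + 1`. [folklore] -/
theorem length_gateOpF_le (f : List Bool → List Bool) (z : List Bool) : (gateOpF f z).length ≤ (f z).length + 1 := by
  simp only [gateOpF, Function.comp_apply, List.length_cons]
  have := length_lenBinF_le (f z); omega

/-- **The variable piece**: `varOpF f z = 00 · bin |f z|`, the code of `x_{|f z|}`. [folklore] -/
def varOpF (f : List Bool → List Bool) : List Bool → List Bool := List.cons false ∘ List.cons false ∘ lenBinF ∘ f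

/-- `varOpF f ∈ FP`. [folklore] -/
theorem varOpF_mem_FP {f : List Bool → List Bool} (hf : f ∈ FP) : varOpF f ∈ FP :=
  comp_mem_FP (cons_mem_FP false) (comp_mem_FP (cons_mem_FP false) (comp_mem_FP lenBinF_mem_FP hf))

/-- Value of the variable piece (index in range). [folklore] -/
theorem varOpF_apply {n : ℕ} (f : List Bool → List Bool) (z : List Bool) (h : (f z).length < n * n) :
    varOpF f z = opCode (n * n) ((varEntry n (f z).length).toOperand) := by
  simp [varOpF, varEntry, h, LayerEntry.toOperand]

/-- Length of the variable piece: `≤ |f z| + 2`. [folklore] -/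
theorem length_varOpF_le (f : List Bool → List Bool) (z : List Bool) : (varOpF f z).length ≤ (f z).length + 2 := by
  simp only [varOpF, Function.comp_apply, List.length_cons]
  have := length_lenBinF_le (f z); omega

/-- **The input-value piece** on a piece `g` extracting `w₀`: the code of the constant
`v = ⟦vcStr w₀⟧`, `01 · ⟨[0], bin v⟩` (the canonical numeral by `addFn ⟨vc, ε⟩`). [folklore] -/
def constVOpF (g : List Bool → List Bool) : List Bool → List Bool :=
  List.cons false ∘ List.cons true ∘ fanoutFn (fun _ => [false]) (addFn ∘ fanoutFn (vcF ∘ g) (fun _ => []))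

/-- `constVOpF g ∈ FP`. [folklore] -/
theorem constVOpF_mem_FP {g : List Bool → List Bool} (hg : g ∈ FP) : constVOpF g ∈ FP :=
  comp_mem_FP (cons_mem_FP false) (comp_mem_FP (cons_mem_FP true)
    (fanoutFn_mem_FP (const_mem_FP _) (comp_mem_FP addFn_mem_FP (fanoutFn_mem_FP (comp_mem_FP vcF_mem_FP hg) (const_mem_FP _)))))

/-- The parsed value `v`. [folklore] -/
def vOf (w₀ : List Bool) : ℕ := bitsToNat (vcStr w₀)

/-- The code of a non-negative integer. [folklore] -/
theorem intCode_natCast (m : ℕ) : intCode (m : ℤ) = boolPair [false] (encodeNat m) := by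
  rw [intCode_eq, Int.natAbs_natCast, decide_eq_false (not_lt.2 (Int.natCast_nonneg m))]

/-- Value of the input-value piece: the code of `const v`. [folklore] -/
theorem constVOpF_apply (N : ℕ) {g : List Bool → List Bool} {z : List Bool} (w₀ : List Bool) (hg : g z = w₀) :
    constVOpF g z = opCode N (.const (vOf w₀ : ℤ)) := by
  rw [opCode_const, intCode_natCast]
  simp [constVOpF, hg, vOf]

/-- Length of the input-value piece: `≤ |w₀| + 7`. [folklore] -/
theorem length_constVOpF_le {g : List Bool → List Bool} {z : List Bool} (w₀ : List Bool) (hg : g z = w₀) :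
    (constVOpF g z).length ≤ w₀.length + 7 := by
  simp only [constVOpF, Function.comp_apply, fanoutFn_apply, hg, vcF_apply, List.length_cons, length_boolPair,
    List.length_nil]
  have h := length_addFn_le (boolPair (vcStr w₀) [])
  simp only [fstF_boolPair, sndF_boolPair, List.length_nil] at h
  have := length_vcStr_le w₀
  omega

/-! ### Frames of the identity gates -/

/-- **The frame of a binary sum gate** `c₁ • u₁ + c₂ • u₂` whose operand codes are written by `f₁, f₂`. [folklore] -/
def sum2F (c₁ c₂ : ℤ) (f₁ f₂ : List Bool → List Bool) : List Bool → List Bool :=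
  frameF (List.cons false ∘ fanoutFn (fun _ => [true, true])
    (fanoutFn (fanoutFn (fun _ => intCode c₁) f₁) (fanoutFn (fanoutFn (fun _ => intCode c₂) f₂) (fun _ => []))))

/-- `sum2F c₁ c₂ f₁ f₂ ∈ FP`. [folklore] -/
theorem sum2F_mem_FP (c₁ c₂ : ℤ) {f₁ f₂ : List Bool → List Bool} (h₁ : f₁ ∈ FP) (h₂ : f₂ ∈ FP) : sum2F c₁ c₂ f₁ f₂ ∈ FP :=
  frameF_mem_FP (comp_mem_FP (cons_mem_FP false) (fanoutFn_mem_FP (const_mem_FP _)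
    (fanoutFn_mem_FP (fanoutFn_mem_FP (const_mem_FP _) h₁) (fanoutFn_mem_FP (fanoutFn_mem_FP (const_mem_FP _) h₂) (const_mem_FP _)))))

/-- Value of the sum frame. [folklore] -/
theorem sum2F_apply {N : ℕ} (c₁ c₂ : ℤ) {f₁ f₂ : List Bool → List Bool} {z : List Bool} {u₁ u₂ : Operand ℤ (Fin N)}
    (h₁ : f₁ z = opCode N u₁) (h₂ : f₂ z = opCode N u₂) :
    sum2F c₁ c₂ f₁ f₂ z = boolPair (gateCode N (.sum [(c₁, u₁), (c₂, u₂)])) [] := by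
  rw [gateCode_sum, sum2F, frameF_apply]
  simp [h₁, h₂, ones, encList_cons]

/-- Length of the sum frame. [folklore] -/
theorem length_sum2F (c₁ c₂ : ℤ) (f₁ f₂ : List Bool → List Bool) (z : List Bool) :
    (sum2F c₁ c₂ f₁ f₂ z).length =
      4 * ((f₁ z).length + (f₂ z).length) + 8 * ((intCode c₁).length + (intCode c₂).length) + 40 := by
  rw [sum2F, length_frameF]
  simp only [Function.comp_apply, fanoutFn_apply, List.length_cons, length_boolPair, List.length_nil]
  ring

/-- **The frame of a binary product gate** `u₁ · u₂`. [folklore] -/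
def prod2F (f₁ f₂ : List Bool → List Bool) : List Bool → List Bool :=
  frameF (List.cons true ∘ fanoutFn (fun _ => [true, true]) (fanoutFn f₁ (fanoutFn f₂ (fun _ => []))))

/-- `prod2F f₁ f₂ ∈ FP`. [folklore] -/
theorem prod2F_mem_FP {f₁ f₂ : List Bool → List Bool} (h₁ : f₁ ∈ FP) (h₂ : f₂ ∈ FP) : prod2F f₁ f₂ ∈ FP :=
  frameF_mem_FP (comp_mem_FP (cons_mem_FP true) (fanoutFn_mem_FP (const_mem_FP _)
    (fanoutFn_mem_FP h₁ (fanoutFn_mem_FP h₂ (const_mem_FP _)))))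

/-- Value of the product frame. [folklore] -/
theorem prod2F_apply {N : ℕ} {f₁ f₂ : List Bool → List Bool} {z : List Bool} {u₁ u₂ : Operand ℤ (Fin N)}
    (h₁ : f₁ z = opCode N u₁) (h₂ : f₂ z = opCode N u₂) :
    prod2F f₁ f₂ z = boolPair (gateCode N (.prod [u₁, u₂])) [] := by
  rw [gateCode_prod, prod2F, frameF_apply]
  simp [h₁, h₂, ones, encList_cons]

/-- Length of the product frame. [folklore] -/
theorem length_prod2F (f₁ f₂ : List Bool → List Bool) (z : List Bool) :
    (prod2F f₁ f₂ z).length = 4 * ((f₁ z).length + (f₂ z).length) + 24 := by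
  rw [prod2F, length_frameF]
  simp only [Function.comp_apply, fanoutFn_apply, List.length_cons, length_boolPair, List.length_nil]
  ring

end KIReduction

end Literature.Computability.AlgebraicComplexity

end
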